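import Literature.Computability.Complexity.RossmanMonotoneCliqueProb

/-!
# Route RamseyUncertifiable, crux `RegularResolutionRung` (stmt-PneNP-9818), line `sound-path-bottleneck`:
# coin counting (product weights and coin-driven processes)

Auxiliary file 1 for the registered stub `stub_soundPathCount` (the bottleneck count of
Atserias–Bonacina–de Rezende–Lauria–Nordström–Razborov, arXiv:2012.09476 §6, under the modified path
distribution `D*`). All probabilities of the line are finite weighted sums over the cube `ι → Bool` with the
product weight `μ_p`; we REUSE the tree's toolkit `Literature.Computability.Complexity.prob` /  `pw`
(`RossmanMonotoneCliqueProb.lean`: `prob_mono`, `prob_true`, `prob_or_le`, `prob_exists_le`,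
`prob_forall_eq_true`, …) and add the three facts the count needs on top of it:

* `prob_le_sum_of_cover`: the union bound in covering form;
* `prob_coord_and`: independence of one coordinate from an event not reading it
  (`P[c i₀ = b ∧ E] = bern p b · P[E]`, via the product formula `pw_eq_prod_bern`);
* `prob_forall_exists_le`: on a product cube `κ × β → Bool`, every vertex of a fixed set `B` has some true
  coin with probability `≤ (|κ| p) ^ |B|`;
* `mstep` / `mrun` / `mreads`: a deterministic adaptive process (`query : σ → Option ι`, `next : σ → Bool → σ`)
  driven by the coins (the path process `D*` is an instance) and the "irreversibility" step of Lemma 6.7,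
  `prob_reads_false_le`: if the process is READ-ONCE along its runs from `s` (an explicit `∀`-hypothesis),
  then for a fixed set `S` of coins the probability that within `n` steps it reads `≥ N` coins of `S`, all
  showing `false`, is `≤ (1 - p) ^ N`.

No measure theory is used; this file defines no propositions. The registered sub-goal `spc_coin_anchor`
(closed form of `prob_reads_false_le`) credits the file. [folklore]
-/

set_option linter.dupNamespace false -- `Summit.PneNP.PneNP.…`: single-conjunct summit

noncomputable section

open scoped BigOperators

namespace Summit.PneNP.PneNP.Cruxes.RegularResolutionRung.SoundPathBottleneck

open Finset Literature.Computability.Complexity Literature.Combinatorics.SetFamily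

/-! ## Three more facts on the product weight of `RossmanMonotoneCliqueProb.lean` -/

section Weights

variable {ι : Type*} [Fintype ι] [DecidableEq ι]

/-- Product formula for the weight of a point of the cube: `pw p x = ∏ᵢ bern p (x i)`. -/
theorem pw_eq_prod_bern (p : ℝ) (x : ι → Bool) : pw p x = ∏ i, bern p (x i) := by
  rw [pw, onSet_eq_finsetEquivFun_symm, biasedWeight_eq_prod]
  simp

/-- Union bound in covering form: if every point of `E` lies in some `F g`, `g ∈ G`, then
`P[E] ≤ Σ_{g ∈ G} P[F g]`. -/
theorem prob_le_sum_of_cover {p : ℝ} (hp0 : 0 ≤ p) (hp1 : p ≤ 1) {γ : Type*} (G : Finset γ)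
    (E : (ι → Bool) → Prop) (F : γ → (ι → Bool) → Prop) (h : ∀ c, E c → ∃ g ∈ G, F g c) :
    prob p E ≤ ∑ g ∈ G, prob p (F g) :=
  (prob_mono hp0 hp1 h).trans (prob_exists_le hp0 hp1 G F)

/-- Independence of one coordinate: if `E` does not read coin `i₀`, then
`P[c i₀ = b ∧ E] = bern p b · P[E]`. -/
theorem prob_coord_and (p : ℝ) (i₀ : ι) (b : Bool) (E : (ι → Bool) → Prop)
    (hE : ∀ c b', E (Function.update c i₀ b') ↔ E c) :
    prob p (fun c => c i₀ = b ∧ E c) = bern p b * prob p E := by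
  classical
  set w' : (ι → Bool) → ℝ := fun c => ∏ i ∈ univ.erase i₀, bern p (c i) with hw'
  have hsplit : ∀ c : ι → Bool, pw p c = bern p (c i₀) * w' c := fun c => by
    rw [pw_eq_prod_bern]
    exact (Finset.mul_prod_erase univ (fun i => bern p (c i)) (mem_univ i₀)).symm
  have hw'u : ∀ c b', w' (Function.update c i₀ b') = w' c := by
    intro c b'
    refine Finset.prod_congr rfl fun i hi => ?_
    rw [Function.update_of_ne (Finset.ne_of_mem_erase hi)]
  set T : Bool → ℝ := fun bb => ∑ c : ι → Bool, if c i₀ = bb ∧ E c then w' c else 0 with hT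
  -- the coordinate flip is an involution exchanging the two halves
  have hTT : ∀ bb, T bb = T (!bb) := by
    intro bb
    have hinv : Function.Involutive (fun c : ι → Bool => Function.update c i₀ (!c i₀)) := by
      intro c
      simp only [Function.update_self, Bool.not_not, Function.update_idem, Function.update_eq_self]
    have hc := Equiv.sum_comp hinv.toPerm (fun c => if c i₀ = bb ∧ E c then w' c else 0)
    simp only [hT]
    rw [← hc]
    refine Finset.sum_congr rfl fun c _ => ?_
    simp only [Function.Involutive.coe_toPerm, Function.update_self, hE, hw'u]
    congr 1
    cases bb <;> cases c i₀ <;> simp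
  have hprobE : prob p E = T b := by
    rw [prob_eq_sum_ite p E]
    calc (∑ c : ι → Bool, if E c then pw p c else 0)
        = ∑ c : ι → Bool, ((if c i₀ = true ∧ E c then w' c else 0) * bern p true +
            (if c i₀ = false ∧ E c then w' c else 0) * bern p false) := by
          refine Finset.sum_congr rfl fun c _ => ?_
          rw [hsplit c]
          by_cases h : E c <;> cases c i₀ <;> simp [h, mul_comm]
      _ = T true * bern p true + T false * bern p false := by
          rw [Finset.sum_add_distrib, ← Finset.sum_mul, ← Finset.sum_mul]
      _ = T b * (bern p true + bern p false) := by
          cases b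
          · rw [hTT true]; simp only [Bool.not_true]; ring
          · rw [hTT false]; simp only [Bool.not_false]; ring
      _ = T b := by rw [bern_true_add_bern_false, mul_one]
  rw [hprobE, prob_eq_sum_ite, hT, Finset.mul_sum]
  refine Finset.sum_congr rfl fun c _ => ?_
  split_ifs with h
  · rw [hsplit c, h.1]
  · rw [mul_zero]

/-- Vertex version of `prob_forall_eq_true` on a product cube `κ × β → Bool`: every vertex of a fixed set
`B` has SOME true coin with probability at most `(|κ| p) ^ |B|` (union bound over the choice of the true
coin). -/
theorem prob_forall_exists_le {κ β : Type*} [Fintype κ] [DecidableEq κ] [Fintype β] [DecidableEq β]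
    {p : ℝ} (hp0 : 0 ≤ p) (hp1 : p ≤ 1) (B : Finset β) :
    prob p (fun c : κ × β → Bool => ∀ v ∈ B, ∃ j : κ, c (j, v) = true) ≤
      (Fintype.card κ * p) ^ B.card := by
  classical
  have h1 := prob_le_sum_of_cover hp0 hp1 (B.pi fun _ => (Finset.univ : Finset κ))
    (fun c : κ × β → Bool => ∀ v ∈ B, ∃ j : κ, c (j, v) = true)
    (fun g c => ∀ v (hv : v ∈ B), c (g v hv, v) = true) (fun c hc =>
      ⟨fun v hv => (hc v hv).choose, Finset.mem_pi.2 fun v _ => Finset.mem_univ _,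
        fun v hv => (hc v hv).choose_spec⟩)
  refine h1.trans ?_
  have h2 : ∀ g ∈ B.pi (fun _ => (Finset.univ : Finset κ)),
      prob p (fun c : κ × β → Bool => ∀ v (hv : v ∈ B), c (g v hv, v) = true) = p ^ B.card := by
    intro g _
    have himg : (B.attach.image fun v => (g v.1 v.2, v.1)).card = B.card := by
      rw [Finset.card_image_of_injective _ (fun v w h => Subtype.ext (Prod.mk.inj h).2),
        Finset.card_attach]
    rw [← himg, ← prob_forall_eq_true p]
    refine prob_congr fun c => ?_
    rw [Finset.forall_mem_image]
    constructor
    · intro h v _; exact h v.1 v.2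
    · intro h v hv; exact h (x := ⟨v, hv⟩) (Finset.mem_attach _ _)
  rw [Finset.sum_congr rfl h2, Finset.sum_const, Finset.card_pi, Finset.prod_const, Finset.card_univ,
    nsmul_eq_mul]
  push_cast
  rw [mul_pow]

end Weights

/-! ## Adaptive read-once processes driven by the coins -/

section Machine

variable {ι : Type*} {σ : Type*} (query : σ → Option ι) (next : σ → Bool → σ)

/-- One step of the deterministic process `(query, next)` driven by the coins `c`: read the queried
coin (if any) and move to the next state (a step without a query is an internal move, fed `false`). -/
def mstep (c : ι → Bool) (s : σ) : σ :=
  next s (match query s with | some i => c i | none => false)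

/-- The state after `n` steps from `s`. -/
def mrun (c : ι → Bool) (s : σ) (n : ℕ) : σ := (mstep query next c)^[n] s

/-- The coins read during the first `n` steps from `s`, in chronological order. -/
def mreads (c : ι → Bool) (s : σ) (n : ℕ) : List ι :=
  (List.range n).filterMap fun j => query (mrun query next c s j)

variable {query next}

/-- `mrun` unfolded at the end. -/
theorem mrun_succ (c : ι → Bool) (s : σ) (n : ℕ) :
    mrun query next c s (n + 1) = mstep query next c (mrun query next c s n) :=
  Function.iterate_succ_apply' _ _ _

/-- `mrun` unfolded at the start. -/
theorem mrun_succ' (c : ι → Bool) (s : σ) (n : ℕ) :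
    mrun query next c s (n + 1) = mrun query next c (mstep query next c s) n :=
  Function.iterate_succ_apply _ _ _

/-- No reads in `0` steps. -/
theorem mreads_zero (c : ι → Bool) (s : σ) : mreads query next c s 0 = [] := rfl

/-- `mreads` unfolded at the end. -/
theorem mreads_succ (c : ι → Bool) (s : σ) (n : ℕ) :
    mreads query next c s (n + 1) = mreads query next c s n ++ (query (mrun query next c s n)).toList := by
  unfold mreads
  rw [List.range_succ, List.filterMap_append]
  congr 1

/-- `mreads` unfolded at the start. -/
theorem mreads_succ' (c : ι → Bool) (s : σ) (n : ℕ) :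
    mreads query next c s (n + 1) = (query s).toList ++ mreads query next c (mstep query next c s) n := by
  unfold mreads
  rw [List.range_succ_eq_map, List.filterMap_cons, List.filterMap_map]
  have e : ((fun j => query (mrun query next c s j)) ∘ Nat.succ) =
      fun j => query (mrun query next c (mstep query next c s) j) := by
    funext j; simp only [Function.comp, Nat.succ_eq_add_one, mrun_succ']
  rw [e, mrun]
  simp only [Function.iterate_zero, id_eq]
  cases query s <;> rfl

/-- A read happened at some step. -/
theorem mem_mreads_iff (c : ι → Bool) (s : σ) (n : ℕ) (i : ι) :
    i ∈ mreads query next c s n ↔ ∃ j < n, query (mrun query next c s j) = some i := by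
  unfold mreads
  simp [List.mem_filterMap, List.mem_range]

/-- A step without a query is the internal move `next s false`, whatever the coins. -/
theorem mstep_of_none {s : σ} (hq : query s = none) (c : ι → Bool) :
    mstep query next c s = next s false := by unfold mstep; rw [hq]

/-- A step with a query reads the coin. -/
theorem mstep_of_some {s : σ} {i : ι} (hq : query s = some i) (c : ι → Bool) :
    mstep query next c s = next s (c i) := by unfold mstep; rw [hq]

/-- Read-once (along every run from `s` no coin is queried a second time) passes to the internal
successor. -/
theorem readOnce_next_none {s : σ}
    (hRO : ∀ (c : ι → Bool) (n : ℕ) (i : ι),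
      query (mrun query next c s n) = some i → i ∉ mreads query next c s n)
    (hq : query s = none) :
    ∀ (c : ι → Bool) (n : ℕ) (i : ι), query (mrun query next c (next s false) n) = some i →
      i ∉ mreads query next c (next s false) n := by
  intro c n i hi
  have h1 : mrun query next c s (n + 1) = mrun query next c (next s false) n := by
    rw [mrun_succ', mstep_of_none hq]
  have h2 : mreads query next c s (n + 1) = mreads query next c (next s false) n := by
    rw [mreads_succ', mstep_of_none hq, hq]; rfl
  have := hRO c (n + 1) i (by rw [h1]; exact hi)
  rwa [h2] at this

variable [DecidableEq ι]

/-- KEY (read-once ⇒ the rest of the run ignores the coin just read): after reading `i₀` and moving to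
`next s b`, the run is the same for `c` and for `c` with coin `i₀` overwritten by `b`. -/
theorem mrun_next_update {s : σ}
    (hRO : ∀ (c : ι → Bool) (n : ℕ) (i : ι),
      query (mrun query next c s n) = some i → i ∉ mreads query next c s n)
    {i₀ : ι} (hq : query s = some i₀) (b : Bool) (c : ι → Bool) :
    ∀ n, mrun query next c (next s b) n = mrun query next (Function.update c i₀ b) (next s b) n := by
  set c' := Function.update c i₀ b with hc'
  have hstart : mstep query next c' s = next s b := by
    rw [mstep_of_some hq]; simp [hc']
  intro n
  induction n with
  | zero => rfl
  | succ n ih =>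
    rw [mrun_succ, mrun_succ, ← ih]
    set sn := mrun query next c (next s b) n with hsn
    unfold mstep
    cases hqn : query sn with
    | none => rfl
    | some i =>
      have hrun : mrun query next c' s (n + 1) = sn := by rw [mrun_succ', hstart, ih]
      have hne : i ≠ i₀ := by
        intro h
        subst h
        have := hRO c' (n + 1) i (by rw [hrun]; exact hqn)
        rw [mreads_succ', hq] at this
        exact this (by simp)
      simp [hc', Function.update_of_ne hne]

/-- … hence the reads are the same, -/
theorem mreads_next_update {s : σ}
    (hRO : ∀ (c : ι → Bool) (n : ℕ) (i : ι),
      query (mrun query next c s n) = some i → i ∉ mreads query next c s n)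
    {i₀ : ι} (hq : query s = some i₀) (b : Bool) (c : ι → Bool) (n : ℕ) :
    mreads query next c (next s b) n = mreads query next (Function.update c i₀ b) (next s b) n := by
  unfold mreads
  congr 1
  funext j
  rw [mrun_next_update hRO hq b c j]

/-- … the coin `i₀` is never read again, -/
theorem not_mem_mreads_next {s : σ}
    (hRO : ∀ (c : ι → Bool) (n : ℕ) (i : ι),
      query (mrun query next c s n) = some i → i ∉ mreads query next c s n)
    {i₀ : ι} (hq : query s = some i₀) (b : Bool) (c : ι → Bool) (n : ℕ) :
    i₀ ∉ mreads query next c (next s b) n := by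
  rw [mreads_next_update hRO hq b c n, mem_mreads_iff]
  rintro ⟨j, -, hj⟩
  set c' := Function.update c i₀ b
  have hstart : mstep query next c' s = next s b := by
    rw [mstep_of_some hq]; simp [c']
  have hrun : mrun query next c' s (j + 1) = mrun query next c' (next s b) j := by rw [mrun_succ', hstart]
  have := hRO c' (j + 1) i₀ (by rw [hrun]; exact hj)
  rw [mreads_succ', hq] at this
  exact this (by simp)

/-- … and read-once passes to the successor `next s b`. -/
theorem readOnce_next_some {s : σ}
    (hRO : ∀ (c : ι → Bool) (n : ℕ) (i : ι),
      query (mrun query next c s n) = some i → i ∉ mreads query next c s n)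
    {i₀ : ι} (hq : query s = some i₀) (b : Bool) :
    ∀ (c : ι → Bool) (n : ℕ) (i : ι), query (mrun query next c (next s b) n) = some i →
      i ∉ mreads query next c (next s b) n := by
  intro c n i hi
  set c' := Function.update c i₀ b
  have hstart : mstep query next c' s = next s b := by
    rw [mstep_of_some hq]; simp [c']
  have hrun : mrun query next c' s (n + 1) = mrun query next c (next s b) n := by
    rw [mrun_succ', hstart, ← mrun_next_update hRO hq b c n]
  have hreads : mreads query next c' s (n + 1) = i₀ :: mreads query next c (next s b) n := by
    rw [mreads_succ', hstart, hq, ← mreads_next_update hRO hq b c n]; rfl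
  have := hRO c' (n + 1) i (by rw [hrun]; exact hi)
  rw [hreads, List.mem_cons, not_or] at this
  exact this.2

variable [Fintype ι]

/-- **Adaptive reads of independent coins.** For a read-once process, a fixed set `S` of coins and a
number `N`: the probability that within `n` steps the process reads at least `N` coins of `S` and every
coin of `S` it reads shows `false` is at most `(1 - p) ^ N`. -/
theorem prob_reads_false_le {p : ℝ} (hp0 : 0 ≤ p) (hp1 : p ≤ 1) (S : Finset ι) :
    ∀ (n : ℕ) (s : σ) (N : ℕ),
      (∀ (c : ι → Bool) (n : ℕ) (i : ι),
        query (mrun query next c s n) = some i → i ∉ mreads query next c s n) →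
      prob p (fun c => N ≤ ((mreads query next c s n).filter (· ∈ S)).length ∧
        ∀ i ∈ mreads query next c s n, i ∈ S → c i = false) ≤ (1 - p) ^ N := by
  have h1p : 0 ≤ 1 - p := by linarith
  intro n
  induction n with
  | zero =>
    intro s N _
    rcases Nat.eq_zero_or_pos N with rfl | hN
    · rw [pow_zero]; exact prob_le_one hp0 hp1 _
    · calc _ ≤ prob p (fun _ : ι → Bool => False) :=
            prob_mono hp0 hp1 fun c hc => by rw [mreads_zero] at hc; simp at hc; omega
        _ = 0 := prob_false p
        _ ≤ (1 - p) ^ N := pow_nonneg h1p N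
  | succ n ih =>
    intro s N hRO
    cases hq : query s with
    | none =>
      have hRO' := readOnce_next_none hRO hq
      have hreads : ∀ c, mreads query next c s (n + 1) = mreads query next c (next s false) n := by
        intro c; rw [mreads_succ', mstep_of_none hq, hq]; rfl
      calc _ = prob p (fun c => N ≤ ((mreads query next c (next s false) n).filter (· ∈ S)).length ∧
              ∀ i ∈ mreads query next c (next s false) n, i ∈ S → c i = false) :=
            prob_congr fun c => by rw [hreads c]
        _ ≤ (1 - p) ^ N := ih _ N hRO'
    | some i₀ =>
      -- the event after the first read, from the successor state `next s b`
      set E' : Bool → ℕ → (ι → Bool) → Prop := fun b N' c =>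
        N' ≤ ((mreads query next c (next s b) n).filter (· ∈ S)).length ∧
          ∀ i ∈ mreads query next c (next s b) n, i ∈ S → c i = false with hE'
      have hE'u : ∀ b N' c b', E' b N' (Function.update c i₀ b') ↔ E' b N' c := by
        intro b N' c b'
        have hr : mreads query next (Function.update c i₀ b') (next s b) n =
            mreads query next c (next s b) n := by
          rw [mreads_next_update hRO hq b c n, mreads_next_update hRO hq b (Function.update c i₀ b') n,
            Function.update_idem]
        have hv : ∀ i ∈ mreads query next c (next s b) n, Function.update c i₀ b' i = c i := by
          intro i hi
          rw [Function.update_of_ne]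
          rintro rfl
          exact not_mem_mreads_next hRO hq b c n hi
        simp only [hE', hr]
        exact and_congr Iff.rfl (forall₂_congr fun i hi => by rw [hv i hi])
      have hbound : ∀ b N', prob p (E' b N') ≤ (1 - p) ^ N' := fun b N' =>
        ih (next s b) N' (readOnce_next_some hRO hq b)
      have hreads : ∀ c, mreads query next c s (n + 1) = i₀ :: mreads query next c (next s (c i₀)) n := by
        intro c; rw [mreads_succ', mstep_of_some hq, hq]; rfl
      by_cases hi₀ : i₀ ∈ S
      · rcases Nat.eq_zero_or_pos N with rfl | hN
        · rw [pow_zero]; exact prob_le_one hp0 hp1 _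
        obtain ⟨N', rfl⟩ : ∃ N', N = N' + 1 := ⟨N - 1, by omega⟩
        calc _ ≤ prob p (fun c => c i₀ = false ∧ E' false N' c) := by
              refine prob_mono hp0 hp1 fun c hc => ?_
              rw [hreads c] at hc
              obtain ⟨hlen, hall⟩ := hc
              have hc0 : c i₀ = false := hall i₀ (by simp) hi₀
              refine ⟨hc0, ?_, fun i hi hiS => hall i (by rw [hc0]; exact List.mem_cons_of_mem _ hi) hiS⟩
              rw [hc0, List.filter_cons_of_pos (by simpa using hi₀), List.length_cons] at hlen
              omega
          _ = bern p false * prob p (E' false N') := prob_coord_and p i₀ false _ (hE'u false N')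
          _ ≤ (1 - p) * (1 - p) ^ N' := by
              exact mul_le_mul_of_nonneg_left (hbound false N') h1p
          _ = (1 - p) ^ (N' + 1) := by ring
      · calc _ ≤ prob p (fun c => (c i₀ = false ∧ E' false N c) ∨ (c i₀ = true ∧ E' true N c)) := by
              refine prob_mono hp0 hp1 fun c hc => ?_
              rw [hreads c] at hc
              obtain ⟨hlen, hall⟩ := hc
              rw [List.filter_cons_of_neg (by simpa using hi₀)] at hlen
              have hE : E' (c i₀) N c :=
                ⟨hlen, fun i hi hiS => hall i (List.mem_cons_of_mem _ hi) hiS⟩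
              cases hc0 : c i₀
              · exact Or.inl ⟨rfl, by rw [hc0] at hE; exact hE⟩
              · exact Or.inr ⟨rfl, by rw [hc0] at hE; exact hE⟩
          _ ≤ prob p (fun c => c i₀ = false ∧ E' false N c) + prob p (fun c => c i₀ = true ∧ E' true N c) :=
              prob_or_le hp0 hp1 _ _
          _ = bern p false * prob p (E' false N) + bern p true * prob p (E' true N) := by
              rw [prob_coord_and p i₀ false _ (hE'u false N), prob_coord_and p i₀ true _ (hE'u true N)]
          _ ≤ (1 - p) * (1 - p) ^ N + p * (1 - p) ^ N := by
              exact add_le_add (mul_le_mul_of_nonneg_left (hbound false N) h1p)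
                (mul_le_mul_of_nonneg_left (hbound true N) hp0)
          _ = (1 - p) ^ N := by ring

end Machine

/-- Registered sub-goal `spc_coin_anchor` of stmt-PneNP-9818 (credits this auxiliary file): the closed form of
`prob_reads_false_le`. -/
theorem spc_coin_anchor : ∀ (ι σ : Type) [Fintype ι] [DecidableEq ι] (query : σ → Option ι)
    (next : σ → Bool → σ) (p : ℝ), 0 ≤ p → p ≤ 1 → ∀ (S : Finset ι) (n : ℕ) (s : σ) (N : ℕ),
    (∀ (c : ι → Bool) (n : ℕ) (i : ι), query (mrun query next c s n) = some i → i ∉ mreads query next c s n) →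
    Literature.Computability.Complexity.prob p (fun c => N ≤ ((mreads query next c s n).filter (· ∈ S)).length ∧
      ∀ i ∈ mreads query next c s n, i ∈ S → c i = false) ≤ (1 - p) ^ N :=
  fun _ _ _ _ _ _ _ hp0 hp1 S n s N hRO => prob_reads_false_le hp0 hp1 S n s N hRO

end Summit.PneNP.PneNP.Cruxes.RegularResolutionRung.SoundPathBottleneck
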